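import Summits.BirchSwinnertonDyer.BirchSwinnertonDyer.Theorems.GenusKolyvaginAtTwoEquivariantKolyvaginExactAtTwoDualityRat
import HarnessLib

/-!
# Route `GenusKolyvaginAtTwo`, LINE 6, KEY crux Q3 (inner statement of stmt-BirchSwinnertonDyer-22137):
# the TWO-PLACE reciprocity law — McCallum's display (13) in the proof of Prop. 5.2 (helper, PROVED;
# seat `bsd-line-gk2-p2` g11)

The deepening step of LINE 6 (`Literature/…/HeegnerPointsKolyvaginVisibleDescentDeepeningProofs`, p640533:
McCallum's Prop. 5.2 for `r = 1`, a SHALLOW depth-one certificate yields a DEEP one) consumes the reciprocity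
law in TWO-place form (hypothesis `hrec`): for global classes `a`, `c ∈ H¹(K, E[n])` with `a` Selmer off
`{v₀, v}` and `c` Selmer off `v₀`, the local terms of `∑_w inv_w(a_w ∪ c_w) = 0` vanish off `{v₀, v}`
(isotropy of the Kummer conditions), so the term at `v₀` vanishes iff the term at `v` does. This file proves
it, `inv`-free, over any number field and any level `n` — the two-place twin of seat gk2-p3's
`FrobeniusCriterion.cupProduct_localization_eq_zero_of_selmer_off` (p632018, one place):

* `cupProduct_localization_eq_zero_iff_of_selmer_off_pair` — **`a_{v₀} ∪ c_{v₀} = 0 ⟺ a_v ∪ c_v = 0`**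
  (the Poitou–Tate sum over `S = {v₀, v}`, injectivity of `inv_{v₀}`, `inv_v`);
* `cupProduct_localization_eq_zero_iff_of_selmer_off_pair'` — the same with the Poitou–Tate predicate
  discharged (`poitouTate_sum_localTatePairing_eq_zero_holds`, `K : Type`).

Helper (`--supports` 22137), closes nothing; THEOREMS ONLY, 0 sorry, standard axioms. BSD is not proved by this.

References: [McCallumLMS1991] §2 Prop. 2.2, §5 proof of Prop. 5.2 (display (13)); [MilneADT2006] I Thm. 4.10(b);
[GrossLMS1991] Prop. 8.2 (proof).
-/

set_option autoImplicit false
set_option linter.dupNamespace false -- tree convention: `Summit.BirchSwinnertonDyer.BirchSwinnertonDyer.Theorems` (summit = sub-problem)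

noncomputable section

open scoped Classical Pointwise

universe u

namespace Summit.BirchSwinnertonDyer.BirchSwinnertonDyer.Theorems.GenusExact.FrobeniusCriterion

open WeierstrassCurve NumberField IsDedekindDomain Field
open Literature.NumberTheory.EllipticCurves Literature.NumberTheory.GaloisRepresentations
open Literature.NumberTheory.GaloisCohomology
open Literature.NumberTheory.GaloisRepresentations.DiscreteGaloisModule (mu MuCarrier)
open Summit.BirchSwinnertonDyer.Rank1Residual.X11b

section Global

variable {K : Type u} [Field K] [NumberField K] (W : WeierstrassCurve K) [W.IsElliptic]

/-- **Two-place reciprocity** (McCallum's (13) in the proof of Prop. 5.2; Prop. 2.2 with the isotropy of the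
Kummer conditions): for `E = W/K` elliptic, `n ≥ 1`, an alternating Weil pairing `e` on `E[n]`, two finite
places `v₀ ≠ v`, and classes `a, c ∈ H¹(K, E[n])` with `a` Selmer at every finite place `∉ {v₀, v}` and at
every infinite place, `c` Selmer at every finite place `≠ v₀` and at every infinite place:
**`a_{v₀} ∪ c_{v₀} = 0` in `H²(K_{v₀}, μₙ)` iff `a_v ∪ c_v = 0` in `H²(K_v, μₙ)`.**
[cite: McCallumLMS1991, §5 proof of Prop. 5.2 (13), §2 Prop. 2.2] [cite: MilneADT2006, Ch. I Thm. 4.10(b)] -/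
theorem cupProduct_localization_eq_zero_iff_of_selmer_off_pair
    (hPT : poitouTate_sum_localTatePairing_eq_zero K)
    {n : ℕ} [NeZero n] (e : geomTorsion W n → geomTorsion W n → AlgebraicClosure K)
    (hμ : ∀ S T, e S T ^ n = 1) (hadd₁ : ∀ S₁ S₂ T, e (S₁ + S₂) T = e S₁ T * e S₂ T)
    (hadd₂ : ∀ S T₁ T₂, e S (T₁ + T₂) = e S T₁ * e S T₂) (halt : ∀ T, e T T = 1)
    (hgal : ∀ (σ : absoluteGaloisGroup K) (S T : geomTorsion W n), σ • e S T = e (σ • S) (σ • T))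
    (v₀ v : HeightOneSpectrum (𝓞 K)) (hv : v₀ ≠ v) {a c : galH1Torsion W (n : ℤ)}
    (hafin : ∀ w : HeightOneSpectrum (𝓞 K), w ≠ v₀ → w ≠ v →
      a ∈ selmerLocalKer W (w.adicCompletion K) (n : ℤ))
    (hainf : ∀ w : InfinitePlace K, a ∈ selmerLocalKer W w.Completion (n : ℤ))
    (hcfin : ∀ w : HeightOneSpectrum (𝓞 K), w ≠ v₀ → w ≠ v →
      c ∈ selmerLocalKer W (w.adicCompletion K) (n : ℤ))
    (hcinf : ∀ w : InfinitePlace K, c ∈ selmerLocalKer W w.Completion (n : ℤ)) :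
    (haveI := absoluteGaloisGroup_compactSpace (v₀.adicCompletion K)
    ((weilContPairing W n e hμ hadd₁ hadd₂ hgal).restrict
      (absGaloisRestrict K (v₀.adicCompletion K))).cupProduct
        (galoisCohomology.localization (W.torsionGaloisModule ((n : ℕ) : ℤ)) (Sum.inr v₀) 1 a)
        (galoisCohomology.localization (W.torsionGaloisModule ((n : ℕ) : ℤ)) (Sum.inr v₀) 1 c) = 0) ↔
    (haveI := absoluteGaloisGroup_compactSpace (v.adicCompletion K)
    ((weilContPairing W n e hμ hadd₁ hadd₂ hgal).restrict
      (absGaloisRestrict K (v.adicCompletion K))).cupProduct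
        (galoisCohomology.localization (W.torsionGaloisModule ((n : ℕ) : ℤ)) (Sum.inr v) 1 a)
        (galoisCohomology.localization (W.torsionGaloisModule ((n : ℕ) : ℤ)) (Sum.inr v) 1 c) = 0) := by
  have _hΓc : ∀ (L : Type u) [Field L], CompactSpace (absoluteGaloisGroup L) :=
    fun L _ => absoluteGaloisGroup_compactSpace L
  -- the family of local invariant maps of the Poitou–Tate predicate at level `n`
  obtain ⟨inv, hperf, hsum⟩ := hPT n
  -- the finite set of places `S = {v₀, v}`
  set S : Finset (Place K) := {Sum.inr v₀, Sum.inr v} with hSdef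
  have hmem₀ : (Sum.inr v₀ : Place K) ∈ S := Finset.mem_insert_self _ _
  have hmem : (Sum.inr v : Place K) ∈ S := Finset.mem_insert_of_mem (Finset.mem_singleton_self _)
  have hne : (Sum.inr v₀ : Place K) ≠ Sum.inr v := fun h ↦ hv (Sum.inr_injective h)
  -- off `S` both classes satisfy the Kummer condition (isotropy applies)
  have hloc : ∀ {x : galH1Torsion W (n : ℤ)},
      (∀ w : HeightOneSpectrum (𝓞 K), w ≠ v₀ → w ≠ v →
        x ∈ selmerLocalKer W (w.adicCompletion K) (n : ℤ)) →
      (∀ w : InfinitePlace K, x ∈ selmerLocalKer W w.Completion (n : ℤ)) →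
      ∀ w : Place K, w ∉ S →
        galoisCohomology.localization (W.torsionGaloisModule ((n : ℕ) : ℤ)) w 1 x ∈
          W.kummerSelmerStructure ((n : ℕ) : ℤ) w := by
    intro x hxfin hxinf w hw
    have hmemw : x ∈ selmerLocalKer W (Place.Completion w) ((n : ℕ) : ℤ) := by
      rcases w with w | w
      · exact hxinf w
      · refine hxfin w (fun h => hw ?_) (fun h => hw ?_)
        · rw [h]; exact hmem₀
        · rw [h]; exact hmem
    rw [← W.comap_localization_kummerSelmerStructure ((n : ℕ) : ℤ) w] at hmemw
    exact hmemw
  have hS : ∀ w ∉ S,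
      inv w ((weilContPairingLocal W n e hμ hadd₁ hadd₂ hgal w).cupProduct
        (galoisCohomology.localization (W.torsionGaloisModule ((n : ℕ) : ℤ)) w 1 a)
        (galoisCohomology.localization (W.torsionGaloisModule ((n : ℕ) : ℤ)) w 1 c)) = 0 := by
    intro w hw
    have h0 := W.cupProduct_eq_zero_of_mem_kummerSelmerStructure_of_fact n e
      (by exact_mod_cast NeZero.ne n) w (kummerClass_cupProduct_kummerClass_eq_zero_holds (Place.Completion w))
      hμ hadd₁ hadd₂ halt hgal (hloc hafin hainf w hw) (hloc hcfin hcinf w hw)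
    exact (congrArg (inv w) h0).trans (map_zero _)
  -- Poitou–Tate: the two remaining local terms sum to zero
  have hPTsum := sum_inv_weilCupProduct_localization_eq_zero W n e hμ hadd₁ hadd₂ hgal inv hsum a c S hS
  rw [Finset.sum_pair hne] at hPTsum
  -- `x + y = 0`, `inv` injective at both places
  constructor
  · intro h0
    have h1 : inv (Sum.inr v₀) ((weilContPairingLocal W n e hμ hadd₁ hadd₂ hgal (Sum.inr v₀)).cupProduct
        (galoisCohomology.localization (W.torsionGaloisModule ((n : ℕ) : ℤ)) (Sum.inr v₀) 1 a)
        (galoisCohomology.localization (W.torsionGaloisModule ((n : ℕ) : ℤ)) (Sum.inr v₀) 1 c)) = 0 :=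
      (congrArg (inv (Sum.inr v₀)) h0).trans (map_zero _)
    rw [h1, zero_add] at hPTsum
    exact (hperf v).1.injective (hPTsum.trans (map_zero _).symm)
  · intro h0
    have h1 : inv (Sum.inr v) ((weilContPairingLocal W n e hμ hadd₁ hadd₂ hgal (Sum.inr v)).cupProduct
        (galoisCohomology.localization (W.torsionGaloisModule ((n : ℕ) : ℤ)) (Sum.inr v) 1 a)
        (galoisCohomology.localization (W.torsionGaloisModule ((n : ℕ) : ℤ)) (Sum.inr v) 1 c)) = 0 :=
      (congrArg (inv (Sum.inr v)) h0).trans (map_zero _)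
    rw [h1, add_zero] at hPTsum
    exact (hperf v₀).1.injective (hPTsum.trans (map_zero _).symm)

end Global

/-! ## The Poitou–Tate predicate discharged (`K : Type`) -/

section Discharged

variable {K : Type} [Field K] [NumberField K] (W : WeierstrassCurve K) [W.IsElliptic]

/-- **Two-place reciprocity, unconditional form** (`K : Type`; Poitou–Tate by
`poitouTate_sum_localTatePairing_eq_zero_holds`). [cite: McCallumLMS1991, §5 proof of Prop. 5.2 (13)]
[cite: MilneADT2006, Ch. I Thm. 4.10(b)] -/
theorem cupProduct_localization_eq_zero_iff_of_selmer_off_pair'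
    {n : ℕ} [NeZero n] (e : geomTorsion W n → geomTorsion W n → AlgebraicClosure K)
    (hμ : ∀ S T, e S T ^ n = 1) (hadd₁ : ∀ S₁ S₂ T, e (S₁ + S₂) T = e S₁ T * e S₂ T)
    (hadd₂ : ∀ S T₁ T₂, e S (T₁ + T₂) = e S T₁ * e S T₂) (halt : ∀ T, e T T = 1)
    (hgal : ∀ (σ : absoluteGaloisGroup K) (S T : geomTorsion W n), σ • e S T = e (σ • S) (σ • T))
    (v₀ v : HeightOneSpectrum (𝓞 K)) (hv : v₀ ≠ v) {a c : galH1Torsion W (n : ℤ)}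
    (hafin : ∀ w : HeightOneSpectrum (𝓞 K), w ≠ v₀ → w ≠ v →
      a ∈ selmerLocalKer W (w.adicCompletion K) (n : ℤ))
    (hainf : ∀ w : InfinitePlace K, a ∈ selmerLocalKer W w.Completion (n : ℤ))
    (hcfin : ∀ w : HeightOneSpectrum (𝓞 K), w ≠ v₀ → w ≠ v →
      c ∈ selmerLocalKer W (w.adicCompletion K) (n : ℤ))
    (hcinf : ∀ w : InfinitePlace K, c ∈ selmerLocalKer W w.Completion (n : ℤ)) :
    (haveI := absoluteGaloisGroup_compactSpace (v₀.adicCompletion K)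
    ((weilContPairing W n e hμ hadd₁ hadd₂ hgal).restrict
      (absGaloisRestrict K (v₀.adicCompletion K))).cupProduct
        (galoisCohomology.localization (W.torsionGaloisModule ((n : ℕ) : ℤ)) (Sum.inr v₀) 1 a)
        (galoisCohomology.localization (W.torsionGaloisModule ((n : ℕ) : ℤ)) (Sum.inr v₀) 1 c) = 0) ↔
    (haveI := absoluteGaloisGroup_compactSpace (v.adicCompletion K)
    ((weilContPairing W n e hμ hadd₁ hadd₂ hgal).restrict
      (absGaloisRestrict K (v.adicCompletion K))).cupProduct
        (galoisCohomology.localization (W.torsionGaloisModule ((n : ℕ) : ℤ)) (Sum.inr v) 1 a)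
        (galoisCohomology.localization (W.torsionGaloisModule ((n : ℕ) : ℤ)) (Sum.inr v) 1 c) = 0) :=
  cupProduct_localization_eq_zero_iff_of_selmer_off_pair W (poitouTate_sum_localTatePairing_eq_zero_holds K)
    e hμ hadd₁ hadd₂ halt hgal v₀ v hv hafin hainf hcfin hcinf

end Discharged

end Summit.BirchSwinnertonDyer.BirchSwinnertonDyer.Theorems.GenusExact.FrobeniusCriterion

end
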